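import Literature.QuantumTopology.MixedVerlinde.HandlebodyInvariant
import Literature.Topology.FourManifolds.FramedLinkDiagrams
import HarnessLib

/-!
# Plat words of framed link diagrams: the Décoppet–Haïoun invariant of the trace of a framed link

Bridge between the combinatorial carrier `Literature.Topology.FourManifolds.FramedLinkDiagram`
(`FramedLinkDiagrams.lean`: sliced Morse-position diagrams with component labels and INTEGER
framings, realised into `FramedLink (Fin n)`) and the plat words `PlatWord` on which the
Décoppet–Haïoun invariant `mixedVerlindeHandlebodyInvariant p A m w` of a 4-dimensional
2-handlebody is computed (`HandlebodyInvariant.lean`). Third file of the definition request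
`defn-FramedLinkDiagram.Realises` (its point (3)).

`D.toPlatWord` is a plat word of the 2-handlebody `X_L = B⁴ ∪ (2-handles along L)` — the TRACE of
the framed link drawn by `D` (no 1-handles, no plates) — in the input format of
`HandlebodyInvariant.lean` (module docstring there, "Input format"):

* the slices of `D` are copied with component `c` labelled `Strand.handle c` and all positions
  shifted by one, the cut-open blue skein `Γ₀` being the through-strand at position `0`;
* right after the first minimum of each component `c`, a FINGER of `Γ₀` reaches the component:
  `Γ₀` crosses OVER the strands `1, …, q + 1` to sit immediately to the right of the left branch
  of that minimum, the chromatic box `chrom` is applied ("the red curve immediately to the LEFT of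
  a `Γ₀` strand", exactly one per 2-handle), and the finger returns over the same strands — so
  `Γ₀` stays an unknot bounding a disc disjoint from everything (Décoppet–Haïoun (2025), §1.3,
  Fig. 1; Costantino–Geer–Haïoun–Patureau-Mirand, Lemma 2.3: the red-to-blue modification may be
  performed at any point of the red curve);
* then `framing c - writhe c` curls of Décoppet–Haïoun's type (`cup (s+1), cross s (0 < t),
  cap (s+1)` on the upward branch `s` of that minimum; a positive curl is a right-handed kink,
  blackboard framing `+1`, their twist `θ`, cf. `curls`/`unknotWord`) make the BLACKBOARD framing
  of the word equal to the integer framing of `D` (Gompf–Stipsicz (1999), §4.4).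

Hence `D.dhTraceInvariant p A := mixedVerlindeHandlebodyInvariant p A n D.toPlatWord` is the
number `Ṡ^{ζ^{1/2}}_{p^{(2)}}(X_L) ∈ k` of Décoppet–Haïoun (2025), Def. 1.11, for the trace of the
framed link — a function of DIAGRAMS, computable on closed terms.

## What is deliberately NOT here

* No named fact. That `dhTraceInvariant` is invariant under the moves of
  `FramedLinkDiagramMoves.lean` (`Move`: Turaev moves, reversal, renumbering, handle slides) is
  Décoppet–Haïoun's Corollary (p. 4: `Ṡ` is an invariant of 2-handlebodies up to 2-equivalence)
  together with the independence of the value from the positions of the fingers and boxes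
  (CGHP, Lemma 2.3) — modulo the two encodings; vendoring a move-invariance statement for plat
  words is the route item `VrlSkeinFunctorial` (module docstring of `HandlebodyInvariant.lean`,
  "What is cited, not proved here"), so it is not asserted in `Literature/`. Once proved there, it
  feeds `FramedLinkDiagram.apply_eq_of_isStrictHandleSlideEquivalent` (`FramedLinkDiagramMoves`).
* Not the route's `σ_p`: that is `Ṡ` of the DUAL handlebody `W` of an R-link (dotted circles and
  plates, `mixedVerlindeRLinkInvariant`), whose plat word depends on a trivialisation of the
  surgered boundary `#ⁿ(S¹ × S²)`, i.e. on a Kirby-move certificate, not on the diagram of `L`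
  alone ("producing `w` from `(L, sphere system)` is Kirby calculus … the certificate-writer's
  task", ibid.). `dhTraceInvariant` is the invariant of `X_L` itself; for an R-link slid to the
  `0`-framed unlink it equals the value on `unlinkDiagram n`.

## References

* T. D. Décoppet, B. Haïoun, arXiv:2512.14849 (2025), §1.3 (the recipe, Fig. 1), Def. 1.11,
  Corollary p. 4, §2.5 and §4.1 (the twist `θ` and the curls). [DecoppetHaioun2025]
* F. Costantino, N. Geer, B. Haïoun, B. Patureau-Mirand, SIGMA 22 (2026) 034, Lemma 2.3.
  [CostantinoEtAl2026]
* R. E. Gompf, A. I. Stipsicz (1999), §4.4 (blackboard framing and writhe). [GompfStipsicz1999]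
-/

namespace Literature.QuantumTopology.MixedVerlinde

open Literature.Topology.FourManifolds

/-- **A finger of `Γ₀` carrying a chromatic box**: the `Γ₀` strand at position `0` crosses over the
strands `1, …, q + 1` (after which the strand formerly at `q + 1` is at `q` and `Γ₀` at `q + 1`),
the box `chrom q` is applied (handle strand at `q`, `Γ₀` at `q + 1`), and `Γ₀` returns over the
same strands to position `0`. Going over everything both ways, the finger is an isotopy of `Γ₀`
in the complement of the link, so `Γ₀` remains a split unknot. Décoppet–Haïoun (2025), §1.3,
Fig. 1. [cite: DecoppetHaioun2025, §1.3] -/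
def fingerChrom (q : ℕ) : PlatWord :=
  (List.range (q + 1)).map (fun i => Slice.cross i true) ++ [Slice.chrom q] ++
    ((List.range (q + 1)).reverse.map fun i => Slice.cross i false)

/-- **`|t|` curls of sign `sign t`** of Décoppet–Haïoun's type on the upward strand of handle `c`
at position `s`: each is `cup (s + 1), cross s (0 < t), cap (s + 1)` (a kink on the right of the
strand; a positive one is right-handed, blackboard framing `+1`, the twist `θ`). Décoppet–Haïoun
(2025), §2.5, §4.1 (`curls`). [cite: DecoppetHaioun2025, §4.1] -/
def dhCurls (c s : ℕ) (t : ℤ) : PlatWord :=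
  (List.replicate t.natAbs
    [Slice.cup (s + 1) (Strand.handle c), Slice.cross s (decide (0 < t)), Slice.cap (s + 1)]).flatten

/-- Translate one slice of a framed link diagram (labels in `Fin n`) into a plat slice, shifting
positions by one (the `Γ₀` strand occupies position `0`). [cite: DecoppetHaioun2025, §1.3] -/
def platSlice {n : ℕ} : FramedLinkDiagram.Slice (Fin n) → Slice
  | .cup i c _ => Slice.cup (i + 1) (Strand.handle c.val)
  | .cap i => Slice.cap (i + 1)
  | .cross i o => Slice.cross (i + 1) o

/-- The translation with fingers and curls inserted after the first minimum of each component
(`seen` = the components already met): for the first `cup q c ltr` of `c`, append the finger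
`fingerChrom q` (box on the left branch, at shifted position `q + 1`) and `t c` curls on the
upward branch (shifted position `q + 2` if `ltr`, else `q + 1`). [cite: DecoppetHaioun2025, §1.3] -/
def platWordFrom {n : ℕ} (t : Fin n → ℤ) :
    List (Fin n) → List (FramedLinkDiagram.Slice (Fin n)) → PlatWord
  | _, [] => []
  | seen, s :: w =>
      match s with
      | .cup q c ltr =>
          if c ∈ seen then platSlice s :: platWordFrom t seen w
          else platSlice s :: (fingerChrom q ++ dhCurls c.val (if ltr then q + 2 else q + 1) (t c) ++
            platWordFrom t (c :: seen) w)
      | _ => platSlice s :: platWordFrom t seen w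

/-- **The plat word of the trace of a framed link diagram**: a dotted-circle-free Kirby diagram of
`X_L = B⁴ ∪ (2-handles along L)` together with the cut-open skein `Γ₀` (through-strand at position
`0`, one finger and chromatic box per component) and blackboard framings adjusted to the integer
framings of `D` by `framing c - writhe c` curls (`FramedLinkDiagram.twistDefect`), in the input
format of `mixedVerlindeHandlebodyInvariant` (handles labelled `0, …, n - 1`).
Décoppet–Haïoun (2025), §1.3; Gompf–Stipsicz (1999), §4.4. [cite: DecoppetHaioun2025, §1.3] -/
def _root_.Literature.Topology.FourManifolds.FramedLinkDiagram.toPlatWord {n : ℕ}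
    (D : FramedLinkDiagram (Fin n)) : PlatWord :=
  platWordFrom D.twistDefect [] D.word

/-- **The Décoppet–Haïoun invariant of the trace of the framed link drawn by `D`**:
`Ṡ^{ζ^{1/2}}_{p^{(2)}}(X_L) = mixedVerlindeHandlebodyInvariant p A n D.toPlatWord` (for a prime
`p > 3` and `A⁴ = -1` in a field of characteristic `p`; whatever the formula gives otherwise).
A function of diagrams; its invariance under the diagram moves (Décoppet–Haïoun (2025),
Corollary p. 4, with CGHP Lemma 2.3) is NOT asserted here (route item `VrlSkeinFunctorial`).
This is the invariant of `X_L`, not the route's `σ_p` of the dual handlebody (module docstring).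
[cite: DecoppetHaioun2025, Def. 1.11] -/
noncomputable def _root_.Literature.Topology.FourManifolds.FramedLinkDiagram.dhTraceInvariant
    {k : Type*} [Field k] (p : ℕ) (A : k) {n : ℕ} (D : FramedLinkDiagram (Fin n)) : k :=
  mixedVerlindeHandlebodyInvariant p A n D.toPlatWord

/-- On the empty diagram (no component: `X = B⁴`, i.e. `D⁴` with its 4-handle turned over) the
plat word is empty and the invariant is `Ṡ(D⁴) = 1` (`mixedVerlindeHandlebodyInvariant_nil`).
[cite: DecoppetHaioun2025, §4] -/
theorem dhTraceInvariant_unlinkDiagram_zero {k : Type*} [Field k] (p : ℕ) (A : k) :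
    (FramedLinkDiagram.unlinkDiagram 0).dhTraceInvariant p A = 1 :=
  mixedVerlindeHandlebodyInvariant_nil p A

/-- The plat word of the `0`-framed unknot diagram `unlinkDiagram 1`: the cup (to the right of
`Γ₀`), the finger `cross 0 true, chrom 0, cross 0 false` reaching its left branch, no curl
(writhe `0 =` framing), the cap — the picture of `unknotWord 0` with the handle drawn on the other
side of `Γ₀` and the finger made explicit. [folklore] -/
example : (FramedLinkDiagram.unlinkDiagram 1).toPlatWord =
    [Slice.cup 1 (Strand.handle 0), Slice.cross 0 true, Slice.chrom 0, Slice.cross 0 false,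
      Slice.cap 1] := by
  decide

end Literature.QuantumTopology.MixedVerlinde
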